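import Literature.RingTheory.MvPolynomial.RuppertMatrix
import Literature.RingTheory.MvPolynomial.KaltofenNoetherFormsLogicProofs
import Literature.RingTheory.MvPolynomial.NoetherFormsBertini
import Literature.ModelTheory.ExponentialFields.SemialgebraicCountableFibres
import HarnessLib

/-!
# Generic plane sections of the irreducible factors: irreducible, of the same degree

Support file for the Gao–Ruppert count of absolute factors under reduction (sibling
`RuppertGaoSectionsDistinct.lean`: sections of non-associated factors are non-associated). For
`f ∈ K[x₁, …, xₙ]` the tree's generic plane section `planeSect f = f(μ + vX + zY)`
(`RuppertMatrix.lean`, indeterminate parameters) is read in `Ω[X, Y]`, `Ω` the algebraic closure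
of `K(z, μ, v)`. After E. Kaltofen, J. Comput. System Sci. 50 (1995) 274–295, §5 Lemma 7 (generic
plane sections of absolutely irreducible polynomials are absolutely irreducible; tree theorem
`irreducible_planeSection_of_algebraicIndependent`) and §4 Lemma 3 (the generic line section is
squarefree; tree `resultant_genericLine_derivative_ne_zero`):

* `Ruppert.irreducible_map_planeSect` — `f` absolutely irreducible ⇒ its generic section is
  irreducible in `Ω[X, Y]`;
* `Ruppert.totalDegree_map_planeSect` — the section has total degree `deg f`.

No definitions, no named facts; helpers private.

## References

* E. Kaltofen, J. Comput. System Sci. 50 (1995) 274–295, §4 Lemma 3, §5 Lemma 7. [`Kaltofen1995`]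
-/

noncomputable section

open MvPolynomial
open scoped Polynomial

universe u

namespace Literature.RingTheory.MvPolynomial

namespace Ruppert

open Literature.NumberTheory.DiophantineGeometry

variable {K : Type u} [Field K] {n : ℕ}

/-! ### The field `Ω = \overline{K(z, μ, v)}` and the generic parameters -/

/-- `K[z, μ, v] → Ω` is injective. [folklore] -/
private theorem algebraMap_params_injective :
    Function.Injective (algebraMap (MvPolynomial (Params n) K)
      (AlgebraicClosure (FractionRing (MvPolynomial (Params n) K)))) := by
  rw [IsScalarTower.algebraMap_eq (MvPolynomial (Params n) K) (FractionRing (MvPolynomial (Params n) K))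
    (AlgebraicClosure (FractionRing (MvPolynomial (Params n) K))), RingHom.coe_comp]
  exact (algebraMap (FractionRing (MvPolynomial (Params n) K)) _).injective.comp
    (IsFractionRing.injective (MvPolynomial (Params n) K) (FractionRing (MvPolynomial (Params n) K)))

/-- The parameters are algebraically independent over `K` in `Ω`. [folklore] -/
private theorem algebraicIndependent_params :
    AlgebraicIndependent K (fun q : Params n =>
      algebraMap (MvPolynomial (Params n) K) (AlgebraicClosure (FractionRing (MvPolynomial (Params n) K)))
        (X q)) := by
  change Function.Injective (MvPolynomial.aeval _)
  have h : (MvPolynomial.aeval (fun q : Params n => algebraMap (MvPolynomial (Params n) K)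
      (AlgebraicClosure (FractionRing (MvPolynomial (Params n) K))) (X q)) :
        MvPolynomial (Params n) K →ₐ[K] AlgebraicClosure (FractionRing (MvPolynomial (Params n) K))) =
      IsScalarTower.toAlgHom K (MvPolynomial (Params n) K) _ := by
    rw [MvPolynomial.aeval_unique (IsScalarTower.toAlgHom K (MvPolynomial (Params n) K) _)]
    rfl
  rw [h]
  exact algebraMap_params_injective

/-- **Bridge**: read in `Ω[Y][X]` (`finTwoEquiv`: `X = X 0` outer, `Y = X 1` inner), the generic
section is Kaltofen's `f(μ + vX + zY)` with the parameters `μ, v, z ∈ Ω`. [folklore] -/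
private theorem finTwoEquiv_map_planeSect {A : Type*} [CommRing A] (ι : MvPolynomial (Params n) K →+* A)
    (f : MvPolynomial (Fin n) K) :
    finTwoEquiv A (MvPolynomial.map ι (planeSect f)) = MvPolynomial.aeval (fun i ↦
      (Polynomial.C (Polynomial.C (ι (X (Sum.inr (Sum.inl i))))) +
        Polynomial.C (Polynomial.C (ι (X (Sum.inr (Sum.inr i))))) * Polynomial.X +
        Polynomial.C (Polynomial.C (ι (X (Sum.inl i))) * Polynomial.X) : Polynomial (Polynomial A)))
      (MvPolynomial.map (ι.comp C) f) := by
  have key : ((finTwoEquiv A : MvPolynomial (Fin 2) A →+* Polynomial (Polynomial A)).comp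
      ((MvPolynomial.map ι).comp (eval₂Hom (C.comp C) (sectSubst (A := K) n)))) =
      (MvPolynomial.aeval (fun i ↦
        (Polynomial.C (Polynomial.C (ι (X (Sum.inr (Sum.inl i))))) +
          Polynomial.C (Polynomial.C (ι (X (Sum.inr (Sum.inr i))))) * Polynomial.X +
          Polynomial.C (Polynomial.C (ι (X (Sum.inl i))) * Polynomial.X) :
            Polynomial (Polynomial A)))).toRingHom.comp (MvPolynomial.map (ι.comp C)) := by
    refine MvPolynomial.ringHom_ext (fun a => ?_) (fun i => ?_)
    · simp only [RingHom.coe_comp, Function.comp_apply, eval₂Hom_C, map_C, AlgHom.toRingHom_eq_coe,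
        RingHom.coe_coe, MvPolynomial.algHom_C, Polynomial.algebraMap_apply]
      exact finTwoEquiv_C A _
    · simp only [RingHom.coe_comp, Function.comp_apply, eval₂Hom_X', map_X, AlgHom.toRingHom_eq_coe,
        RingHom.coe_coe, MvPolynomial.aeval_X, sectSubst, map_add, map_mul, map_C, map_X,
        finTwoEquiv_C, finTwoEquiv_X_zero, finTwoEquiv_X_one]
  exact DFunLike.congr_fun key f

/-! ### Irreducibility of the generic section -/

/-- **The generic plane section of an absolutely irreducible polynomial is irreducible over
`Ω = \overline{K(z, μ, v)}`** (Kaltofen's Lemma 7 for the tree's `planeSect`; the genericity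
conditions — top form non-vanishing at `v`, squarefree line section — hold for indeterminate
parameters by algebraic independence and Lemma 3). [cite: Kaltofen1995, §5 Lemma 7] -/
theorem irreducible_map_planeSect {f : MvPolynomial (Fin n) K} (hf : IsAbsIrreducible f) :
    Irreducible (MvPolynomial.map (algebraMap (MvPolynomial (Params n) K)
      (AlgebraicClosure (FractionRing (MvPolynomial (Params n) K)))) (planeSect f)) := by
  classical
  set ι := algebraMap (MvPolynomial (Params n) K) (AlgebraicClosure (FractionRing (MvPolynomial (Params n) K)))
    with hι
  have hιinj : Function.Injective ι := algebraMap_params_injective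
  have hιC : ι.comp C = algebraMap K _ := by
    ext a
    rw [RingHom.comp_apply, ← MvPolynomial.algebraMap_eq, ← IsScalarTower.algebraMap_apply]
  have hf0 : f ≠ 0 := by
    intro h; rw [h] at hf; exact hf.ne_zero (by simp)
  have hfd : 1 ≤ f.totalDegree := by
    by_contra h0
    have h0' : f.totalDegree = 0 := by omega
    rw [totalDegree_eq_zero_iff_eq_C] at h0'
    have hc : coeff 0 f ≠ 0 := fun hc => hf0 (by rw [h0', hc, C_0])
    apply hf.not_isUnit
    rw [h0', map_C]
    exact ((map_ne_zero_iff _ (algebraMap K (AlgebraicClosure K)).injective).mpr hc).isUnit.map C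
  -- transport to `Ω[Y][X]`
  rw [← MulEquiv.irreducible_iff (finTwoEquiv _ : MvPolynomial (Fin 2) _ ≃ₐ[_] _).toMulEquiv]
  change Irreducible (finTwoEquiv _ (MvPolynomial.map ι (planeSect f)))
  rw [finTwoEquiv_map_planeSect, hιC, MvPolynomial.aeval_map_algebraMap]
  -- Lemma 7's hypotheses
  have hind := algebraicIndependent_params (K := K) (n := n)
  have hind' : AlgebraicIndependent K (Sum.elim (fun i => ι (X (Sum.inl i)))
      (Sum.elim (fun i => ι (X (Sum.inr (Sum.inl i)))) (fun i => ι (X (Sum.inr (Sum.inr i)))))) := by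
    have h1 : (Sum.elim (fun i => ι (X (Sum.inl i)))
        (Sum.elim (fun i => ι (X (Sum.inr (Sum.inl i)))) (fun i => ι (X (Sum.inr (Sum.inr i)))))) =
        fun q : Params n => ι (X q) := by
      funext q; rcases q with i | i | i <;> rfl
    rw [h1]; exact hind
  have hv : AlgebraicIndependent K (fun i : Fin n => ι (X (Sum.inr (Sum.inr i)))) :=
    hind.comp _ (Sum.inr_injective.comp Sum.inr_injective)
  have hvtop : MvPolynomial.aeval (fun i => ι (X (Sum.inr (Sum.inr i))))
      (homogeneousComponent f.totalDegree f) ≠ 0 :=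
    aeval_ne_zero_of_algebraicIndependent hv (homogeneousComponent_totalDegree_ne_zero hf0)
  -- separability of the line section, from Lemma 3
  set g : Polynomial (MvPolynomial (Params n) K) := MvPolynomial.aeval (fun i ↦
      Polynomial.C (X (Sum.inr (Sum.inl i))) + Polynomial.C (X (Sum.inr (Sum.inr i))) * Polynomial.X :
        Fin n → Polynomial (MvPolynomial (Params n) K)) f with hg_def
  have hres := resultant_genericLine_derivative_ne_zero hf
  rw [← hg_def] at hres
  have hgΩ : g.map ι = MvPolynomial.aeval (fun i => Polynomial.C (ι (X (Sum.inr (Sum.inl i)))) +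
      Polynomial.C (ι (X (Sum.inr (Sum.inr i)))) * Polynomial.X :
        Fin n → (AlgebraicClosure (FractionRing (MvPolynomial (Params n) K)))[X]) f := by
    have key : (Polynomial.mapRingHom ι).comp (MvPolynomial.aeval (R := K) (fun i ↦
        Polynomial.C (X (Sum.inr (Sum.inl i))) + Polynomial.C (X (Sum.inr (Sum.inr i))) * Polynomial.X :
          Fin n → Polynomial (MvPolynomial (Params n) K))).toRingHom =
        (MvPolynomial.aeval (R := K) (fun i => Polynomial.C (ι (X (Sum.inr (Sum.inl i)))) +
          Polynomial.C (ι (X (Sum.inr (Sum.inr i)))) * Polynomial.X :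
            Fin n → (AlgebraicClosure (FractionRing (MvPolynomial (Params n) K)))[X])).toRingHom := by
      refine MvPolynomial.ringHom_ext (fun a => ?_) (fun i => ?_)
      · simp only [AlgHom.toRingHom_eq_coe, RingHom.coe_comp, RingHom.coe_coe, Function.comp_apply,
          MvPolynomial.algHom_C, Polynomial.algebraMap_apply, Polynomial.coe_mapRingHom, Polynomial.map_C]
        rw [hι, ← IsScalarTower.algebraMap_apply]
      · simp only [AlgHom.toRingHom_eq_coe, RingHom.coe_comp, RingHom.coe_coe, Function.comp_apply,
          MvPolynomial.aeval_X, Polynomial.coe_mapRingHom, Polynomial.map_add, Polynomial.map_mul,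
          Polynomial.map_C, Polynomial.map_X]
    rw [hg_def]
    exact DFunLike.congr_fun key f
  have hgdeg : g.natDegree ≤ f.totalDegree :=
    Literature.ModelTheory.ExponentialFields.natDegree_aeval_le_totalDegree f _ fun i =>
      (Polynomial.natDegree_add_le _ _).trans (max_le (by rw [Polynomial.natDegree_C]; exact Nat.zero_le _)
        ((Polynomial.natDegree_C_mul_le _ _).trans Polynomial.natDegree_X_le))
  have hsep : (MvPolynomial.aeval (fun i => Polynomial.C (ι (X (Sum.inr (Sum.inl i)))) +
      Polynomial.C (ι (X (Sum.inr (Sum.inr i)))) * Polynomial.X :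
        Fin n → (AlgebraicClosure (FractionRing (MvPolynomial (Params n) K)))[X]) f).Separable := by
    rw [← hgΩ, Polynomial.separable_def]
    set d := f.totalDegree with hd
    have hgΩdeg : (g.map ι).natDegree ≤ d := Polynomial.natDegree_map_le.trans hgdeg
    have hgΩ'deg : (Polynomial.derivative (g.map ι)).natDegree ≤ d - 1 :=
      (Polynomial.natDegree_derivative_le _).trans (Nat.sub_le_sub_right hgΩdeg 1)
    have hd1 : 1 ≤ d := hfd
    obtain ⟨p₁, p₂, -, -, hpq⟩ := Polynomial.exists_mul_add_mul_eq_C_resultant (g.map ι)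
      (Polynomial.derivative (g.map ι)) hgΩdeg hgΩ'deg (Or.inl (by omega))
    have hr : (g.map ι).resultant (Polynomial.derivative (g.map ι)) d (d - 1) =
        ι (g.resultant (Polynomial.derivative g) d (d - 1)) := by
      rw [Polynomial.derivative_map, Polynomial.resultant_map_map]
    rw [hr] at hpq
    have hr0 : ι (g.resultant (Polynomial.derivative g) d (d - 1)) ≠ 0 :=
      (map_ne_zero_iff ι hιinj).2 hres
    refine ⟨Polynomial.C (ι (g.resultant (Polynomial.derivative g) d (d - 1)))⁻¹ * p₁,
      Polynomial.C (ι (g.resultant (Polynomial.derivative g) d (d - 1)))⁻¹ * p₂, ?_⟩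
    calc Polynomial.C (ι (g.resultant (Polynomial.derivative g) d (d - 1)))⁻¹ * p₁ * g.map ι +
        Polynomial.C (ι (g.resultant (Polynomial.derivative g) d (d - 1)))⁻¹ * p₂ *
          Polynomial.derivative (g.map ι)
        = Polynomial.C (ι (g.resultant (Polynomial.derivative g) d (d - 1)))⁻¹ *
            (g.map ι * p₁ + Polynomial.derivative (g.map ι) * p₂) := by ring
      _ = 1 := by rw [hpq, ← Polynomial.C_mul, inv_mul_cancel₀ hr0, Polynomial.C_1]
  exact irreducible_planeSection_of_algebraicIndependent hf _ _ _ hind' hvtop hsep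

/-! ### The degree of the section -/

/-- `K → K[z, μ, v] → Ω` is the structure map. [folklore] -/
private theorem algebraMap_params_comp_C :
    (algebraMap (MvPolynomial (Params n) K) (AlgebraicClosure (FractionRing (MvPolynomial (Params n) K)))).comp C =
      algebraMap K _ := by
  ext a
  rw [RingHom.comp_apply, ← MvPolynomial.algebraMap_eq, ← IsScalarTower.algebraMap_apply]

/-- The generic section has total degree `≤ deg f`. [folklore] -/
private theorem totalDegree_map_planeSect_le (f : MvPolynomial (Fin n) K) :
    (MvPolynomial.map (algebraMap (MvPolynomial (Params n) K)
      (AlgebraicClosure (FractionRing (MvPolynomial (Params n) K)))) (planeSect f)).totalDegree ≤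
      f.totalDegree := by
  classical
  refine Finset.sup_le fun e he => ?_
  change e.degree ≤ f.totalDegree
  rw [degree_fin_two]
  by_contra hlt
  push Not at hlt
  have hcoeff := coeff_coeff_finTwoEquiv _ (MvPolynomial.map (algebraMap (MvPolynomial (Params n) K)
      (AlgebraicClosure (FractionRing (MvPolynomial (Params n) K)))) (planeSect f)) (e 0) (e 1)
  have he' : Finsupp.single 0 (e 0) + Finsupp.single 1 (e 1) = e := by
    ext i; fin_cases i <;> simp
  rw [he', finTwoEquiv_map_planeSect, algebraMap_params_comp_C,
    KaltofenGeneric.coeff_coeff_planeConst_eq_zero _ _ _ _ (e 0) (e 1)] at hcoeff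
  · exact (mem_support_iff.mp he) hcoeff.symm
  · rw [totalDegree_map_of_injective' f (algebraMap K _).injective]; omega

/-- **The generic section has total degree `deg f`** (the coefficient of `X^{deg f}` is the top
form of `f` at the indeterminate direction `v`). [cite: Kaltofen1995, §5 Lemma 7 (genericity (33))] -/
theorem totalDegree_map_planeSect (f : MvPolynomial (Fin n) K) :
    (MvPolynomial.map (algebraMap (MvPolynomial (Params n) K)
      (AlgebraicClosure (FractionRing (MvPolynomial (Params n) K)))) (planeSect f)).totalDegree =
      f.totalDegree := by
  classical
  refine le_antisymm (totalDegree_map_planeSect_le f) ?_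
  by_cases hf0 : f = 0
  · rw [hf0, totalDegree_zero]; exact Nat.zero_le _
  set ι := algebraMap (MvPolynomial (Params n) K) (AlgebraicClosure (FractionRing (MvPolynomial (Params n) K)))
    with hι
  have hv : AlgebraicIndependent K (fun i : Fin n => ι (X (Sum.inr (Sum.inr i)))) :=
    algebraicIndependent_params.comp _ (Sum.inr_injective.comp Sum.inr_injective)
  have hvtop : MvPolynomial.aeval (fun i => ι (X (Sum.inr (Sum.inr i))))
      (homogeneousComponent f.totalDegree f) ≠ 0 :=
    aeval_ne_zero_of_algebraicIndependent hv (homogeneousComponent_totalDegree_ne_zero hf0)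
  have hdeg : (MvPolynomial.map (algebraMap K (AlgebraicClosure (FractionRing (MvPolynomial (Params n) K)))) f).totalDegree
      = f.totalDegree := totalDegree_map_of_injective' f (algebraMap K _).injective
  have hcoeff := coeff_coeff_finTwoEquiv _ (MvPolynomial.map ι (planeSect f)) f.totalDegree 0
  rw [finTwoEquiv_map_planeSect, algebraMap_params_comp_C, ← hdeg,
    KaltofenGeneric.coeff_planeConst_totalDegree, Polynomial.coeff_C_zero, hdeg,
    homogeneousComponent_map, eval_map, ← MvPolynomial.aeval_def] at hcoeff
  have hne : coeff (Finsupp.single 0 f.totalDegree + Finsupp.single 1 0) (MvPolynomial.map ι (planeSect f)) ≠ 0 := by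
    rw [← hcoeff]; exact hvtop
  have := le_totalDegree (mem_support_iff.mpr hne)
  simp only [Finsupp.single_zero, add_zero] at this
  change (Finsupp.single (0 : Fin 2) f.totalDegree).degree ≤ _ at this
  rwa [Finsupp.degree_single] at this

end Ruppert

end Literature.RingTheory.MvPolynomial

end
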